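import Summits.ResolutionOfSingularities.ResolutionOfSingularities.Theorems.MaxContactCutPlanarCut
import HarnessLib

/-!
# CoefficientCutLaws — decomp-res node «CoefficientCut» (lens-5 g19 rev 1) refining the MaxContactCut aside
31770; tree file 2/4 of the node

Content VERBATIM from the decomp-res lens-5 g19 file `HOME/decomp-res-lens-5/g19/CoefficientCut.lean` rev 1 (sha256
e823b9913123731a ≡
`parts/CoefficientCut-NODE-rev1-e823b991.lean`, 759 l; statements identical to the graded NODE pin e42372fd).  HOME =
run/shared/lean/pub/decomp-res.  Critic: CRITIC-LEDGER rows 135 / 135a CLEARED (DECIDED-MOD-PORT(KNOWN) +1 · MAP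
+1), landing orders
2026-08-30T19:29:50Z / 19:36:14Z.  Host: route `MaxContactCut`, aside 31770 `MaxContactCut.DefectWalksDeep` BY NAME
through the tree's
`ExitLaw.defectWalksDeep_iff_joint'` and the lens-5 g18 node `Theorems/PlanarCut*` + `MaxContactCutPlanarCut`.

Inside the PlanarCut cone (imports `MaxContactCutPlanarCut`): §1 the POSITIVE wall potential `potPos` and its
descent on EVERY planar tail
(`potPos_succ_le`, `potPos_mono`, `potPos_succ_succ_le`, `exists_potPos_eq_zero`, `dead_pos_of_late`,
`exists_dead_pos`), §2 the two state-level
laws of the monomial regime at a TRANSLATED planar move (`fat_pos_of_dead_pos`, `layer_zero_thin_of_translated`,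
`layer_zero_low_of_translated`),
§3 their walk forms (`layer_zero_thin_after_translated`, `layer_zero_low_at_translated`,
`ordZero_lt_at_translated`).  All PROVED.

[WRITER NOTE (decomp-res writer g7): split by the critic's order into `CoefficientCutClasses` (CONE-FREE: the two
classes whose binders use
only tree-free vocabulary — `NoPlanarJointTailsDeep`, `NoSkewJointTailsDeep` VERBATIM — plus the writer's
cone-free restatement
`NoMonomialLedPlanarJointTailsDeep` of PIECE 1 with the PlanarCut letters `sm (layer k a F) i j = 0` spelled out as
`IsMonomialLed`, so that
the route file can import the two asides; the in-cone wiring file proves the restatement EXACT: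
`monomialPlanar_iff_monomialLed`),
`CoefficientCutLaws` (§1–§3, PROVED, imports `MaxContactCutPlanarCut`), `CoefficientCutTangency` (§3b, PROVED)
and `MaxContactCutCoefficientCut`
(§4 VERBATIM: PIECE 1 `NoMonomialPlanarJointTailsDeep` in the lens's letters, the node equation, `closes`, the
exact cut, necessities — plus the
writer's link §4w).  ONE namespace `…Theorems.CoefficientCut` as in the lens; global `set_option` line dropped;
nothing else changed.]

(Sources: BenitoVillamayor2012 Thm. 2.11, Thm. 3.3, §4; KawanoueMatsuki2016 §4–§5 (arXiv:1205.4556 pp. 2, 5,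
7); Hauser2010 §§D–G; HauserPerlega2019; CossartJannsenSaito2020 Thm. 2.14; CossartPiltant2019; Moh1987.)
-/

noncomputable section

open MvPolynomial Finset
open Literature.AlgebraicGeometry.Resolution
open Literature.AlgebraicGeometry.Resolution.Hauser2010
open Literature.AlgebraicGeometry.Resolution.PointBlowup
open Literature.AlgebraicGeometry.Resolution.WeightedBlowup
open Summit.ResolutionOfSingularities.ResolutionOfSingularities.Theses
open Summit.ResolutionOfSingularities.ResolutionOfSingularities.Theorems.TightDefectClasses
open Summit.ResolutionOfSingularities.ResolutionOfSingularities.Theorems.TightDefectStrongWalks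
open Summit.ResolutionOfSingularities.ResolutionOfSingularities.Theorems.ItineraryCutClasses
open Summit.ResolutionOfSingularities.ResolutionOfSingularities.Theorems.BoundaryLedger
open Summit.ResolutionOfSingularities.ResolutionOfSingularities.Theorems.ProximityCut
open Summit.ResolutionOfSingularities.ResolutionOfSingularities.Theorems.ExitLaw
open Summit.ResolutionOfSingularities.ResolutionOfSingularities.Theorems.PlanarCut

namespace Summit.ResolutionOfSingularities.ResolutionOfSingularities.Theorems.CoefficientCut

/-! ## §1 The POSITIVE wall potential: descent on EVERY planar tail (no «wall divides `F_N`» hypothesis) -/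

section Walk

variable {K : Type} [Field K] [DecidableEq K] {q : ℕ} {s₀ : State (Fin 3) K}
variable {i j k : Fin 3} (hij : i ≠ j) (hjk : j ≠ k) (hik : i ≠ k)
include hij hjk hik

omit hij hjk hik in
/-- **The positive wall potential** `potPos t = Σ_{1 ≤ a < q} sm(layer_a(F_t))`: the total strict-multiplicity excess of
the POSITIVE wall layers `1 … q−1` of `F_t` along the plane pair `(i, j)` — the tree's `PlanarCut.pot` MINUS its
layer-`0` term.  Layer `0` (the restriction `G⁽⁰⁾ = F|_{u_k = 0}`) is the part a ghost wall does not control; the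
positive layers (`G⁽ᵃ⁾ = ∂^a_{u_k} F|_{u_k=0}`, the COEFFICIENT DATUM of `F` along the plane `u_k = 0`) transform
autonomously under every planar move (`coeff_pointTransform_planar`), so THEIR potential descends on every planar
tail, ghost or not. [new] -/
def potPos (W : ForcedWalk q s₀) (k i j : Fin 3) (t : ℕ) : ℕ :=
  ∑ a ∈ Finset.Ico 1 q, sm (layer k a (W.st t).F) i j

/-- `potPos` is non-increasing along ANY planar tail. [new] [folklore] -/
theorem potPos_succ_le (hs : IsRoot q s₀) (W : ForcedWalk q s₀) {N : ℕ} (hP : PlanarFrom W k N) {t : ℕ}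
    (ht : N ≤ t) : potPos W k i j (t + 1) ≤ potPos W k i j t := by
  unfold potPos
  apply Finset.sum_le_sum
  intro a ha
  rw [Finset.mem_Ico] at ha
  exact sm_succ_le hij hjk hik hs W hP ht ha.1 ha.2

/-- … hence monotone. [new] [folklore] -/
theorem potPos_mono (hs : IsRoot q s₀) (W : ForcedWalk q s₀) {N : ℕ} (hP : PlanarFrom W k N) {t t' : ℕ}
    (ht : N ≤ t) (htt' : t ≤ t') : potPos W k i j t' ≤ potPos W k i j t := by
  induction t', htt' using Nat.le_induction with
  | base => exact le_rfl
  | succ t' htt' ih => exact (potPos_succ_le hij hjk hik hs W hP (by omega)).trans ih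

/-- **DESCENT AT A PROXIMITY REPEAT ON ANY PLANAR TAIL (PROVED):** `potPos (t+2) + potPos (t+1) ≤ potPos t` when step
`t+1` stays on the newest divisor — the tree's `pot_succ_succ_le` with the layer-`0` hypothesis REMOVED (the proof
never needed it for the positive layers). [new] [folklore] -/
theorem potPos_succ_succ_le (hs : IsRoot q s₀) (W : ForcedWalk q s₀) {N : ℕ} (hP : PlanarFrom W k N) {t : ℕ}
    (ht : N ≤ t) (hS : StaysOnNewest W t) : potPos W k i j (t + 2) + potPos W k i j (t + 1) ≤ potPos W k i j t := by
  classical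
  have hF : ∀ d ∈ (W.st t).F.support, q ≤ d.degree := fun d hd => le_degree_of_mem_support hs W t hd
  have hF' : ∀ d ∈ (step q (W.j t) (W.b t) (W.st t)).F.support, q ≤ d.degree := by
    intro d hd
    rw [← st_succ_F] at hd
    exact le_degree_of_mem_support hs W (t + 1) hd
  obtain ⟨hjk0, hbk0⟩ := hP t ht
  obtain ⟨hjk1, hbk1⟩ := hP (t + 1) (by omega)
  obtain ⟨hne, hbS⟩ := hS
  have hb1 : W.b (t + 1) = 0 := by
    funext l
    rcases PlanarCut.fin3_cases ⟨hne, hjk0, hjk1⟩ l with rfl | rfl | rfl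
    · exact W.onExc (t + 1)
    · exact hbS
    · exact hbk1
  have h2 : (W.st (t + 2)).F = (step q (W.j (t + 1)) 0 (step q (W.j t) (W.b t) (W.st t))).F := by
    rw [← hb1, ← W.st_succ t, ← W.st_succ (t + 1)]
  unfold potPos
  rw [← Finset.sum_add_distrib]
  apply Finset.sum_le_sum
  intro a ha
  rw [Finset.mem_Ico] at ha
  obtain ⟨hpos, haq⟩ := ha
  rw [h2, st_succ_F W t]
  rcases PlanarCut.fin3_cases ⟨hij, hjk, hik⟩ (W.j t) with h | h | h
  · have h1 : W.j (t + 1) = j := by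
      rcases PlanarCut.fin3_cases ⟨hij, hjk, hik⟩ (W.j (t + 1)) with h' | h' | h'
      · exact absurd (h'.trans h.symm) hne
      · exact h'
      · exact absurd h' hjk1
    rw [h, h1, sm_comm, sm_comm (S := layer k a (step q i (W.b t) (W.st t)).F),
      sm_comm (S := layer k a (W.st t).F)]
    rw [h] at hF'
    exact sm_step_step_le hij.symm hik hjk q (W.b t) (by rw [← h]; exact W.onExc t) hbk0 (W.st t) hF hF' hpos haq
  · have h1 : W.j (t + 1) = i := by
      rcases PlanarCut.fin3_cases ⟨hij, hjk, hik⟩ (W.j (t + 1)) with h' | h' | h'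
      · exact h'
      · exact absurd (h'.trans h.symm) hne
      · exact absurd h' hjk1
    rw [h, h1]
    rw [h] at hF'
    exact sm_step_step_le hij hjk hik q (W.b t) (by rw [← h]; exact W.onExc t) hbk0 (W.st t) hF hF' hpos haq
  · exact absurd h hjk0

/-- **THE POSITIVE POTENTIAL DIES ON ANY PLANAR TAIL WITH INFINITELY MANY REPEATS (PROVED).** [new] [folklore] -/
theorem exists_potPos_eq_zero (hs : IsRoot q s₀) (W : ForcedWalk q s₀) {N : ℕ} (hP : PlanarFrom W k N)
    (hSio : ∀ M : ℕ, ∃ t, M ≤ t ∧ StaysOnNewest W t) : ∃ T, N ≤ T ∧ potPos W k i j T = 0 := by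
  suffices h : ∀ n t, N ≤ t → potPos W k i j t ≤ n → ∃ T, N ≤ T ∧ potPos W k i j T = 0 from h _ N le_rfl le_rfl
  intro n
  induction n using Nat.strong_induction_on with
  | _ n ih =>
    intro t ht hle
    rcases Nat.eq_zero_or_pos (potPos W k i j t) with h0 | hpos
    · exact ⟨t, ht, h0⟩
    · obtain ⟨t', htt', hS⟩ := hSio t
      have h1 := potPos_mono hij hjk hik hs W hP ht htt'
      have h2 := potPos_succ_succ_le hij hjk hik hs W hP (le_trans ht htt') hS
      have h3 : potPos W k i j (t' + 2) ≤ potPos W k i j (t' + 1) :=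
        potPos_succ_le hij hjk hik hs W hP (by omega : N ≤ t' + 1)
      exact ih (potPos W k i j (t' + 2)) (by omega) (t' + 2) (by omega) le_rfl

/-- **THE MONOMIAL REGIME (PROVED):** after the positive potential has died, EVERY positive wall layer `1 … q−1` is
monomial-led (`sm = 0`) for ever — the coefficient datum `(G⁽ᵃ⁾, q−a)_{1≤a<q}` has become MONOMIAL in the plane
coordinates (the amplifying marks are in Benito–Villamayor's monomial case, 2012 §4 / Kawanoue–Matsuki
arXiv:1205.4556 §5), and only the restriction `G⁽⁰⁾` is still moving freely. [new] [folklore] -/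
theorem dead_pos_of_late (hs : IsRoot q s₀) (W : ForcedWalk q s₀) {N : ℕ} (hP : PlanarFrom W k N) {T : ℕ}
    (hT : N ≤ T) (hpot : potPos W k i j T = 0) {t : ℕ} (ht : T ≤ t) {a : ℕ} (ha1 : 1 ≤ a) (haq : a < q) :
    sm (layer k a (W.st t).F) i j = 0 := by
  have h1 := potPos_mono hij hjk hik hs W hP hT ht
  rw [hpot, Nat.le_zero] at h1
  exact Finset.sum_eq_zero_iff.mp h1 a (Finset.mem_Ico.mpr ⟨ha1, haq⟩)

/-- Packaging: on a planar tail with infinitely many repeats there is a time `T ≥ N` from which on all positive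
layers are monomial-led. [new] [folklore] -/
theorem exists_dead_pos (hs : IsRoot q s₀) (W : ForcedWalk q s₀) {N : ℕ} (hP : PlanarFrom W k N)
    (hSio : ∀ M : ℕ, ∃ t, M ≤ t ∧ StaysOnNewest W t) :
    ∃ T, N ≤ T ∧ ∀ t, T ≤ t → ∀ a, 1 ≤ a → a < q → sm (layer k a (W.st t).F) i j = 0 := by
  obtain ⟨T, hT, hpot⟩ := exists_potPos_eq_zero hij hjk hik hs W hP hSio
  exact ⟨T, hT, fun t ht a ha1 haq => dead_pos_of_late hij hjk hik hs W hP hT hpot ht ha1 haq⟩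

end Walk

/-! ## §2 In the monomial regime a TRANSLATED planar move exposes layer `0` (two kernel laws of the residual class) -/

section Moves

variable {K : Type} [Field K] [DecidableEq K]
variable {i j k : Fin 3} (hij : i ≠ j) (hjk : j ≠ k) (hik : i ≠ k)
include hij hjk hik

/-- **POSITIVE LAYERS COME OUT FAT (PROVED)** — the tree's `fat_of_dead_layers` with the layer-`0` hypothesis
REMOVED and the conclusion restricted to the positive layers: after a `u_i`-translated planar move in the chart `u_j`
from a state all of whose positive wall layers are monomial-led, every exponent `d'` of the new state with `d'_k ≥ 1`
has off-`i` degree `≥ q`. [new] [folklore] -/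
theorem fat_pos_of_dead_pos (q : ℕ) (b : Fin 3 → K) (hbj : b j = 0) (hbk : b k = 0) (hbi : b i ≠ 0)
    (s : State (Fin 3) K) (hF : ∀ d ∈ s.F.support, q ≤ d.degree)
    (hF' : ∀ d ∈ (step q j b s).F.support, q ≤ d.degree)
    (hdead : ∀ a, 1 ≤ a → a < q → sm (layer k a s.F) i j = 0) :
    ∀ d' ∈ (step q j b s).F.support, 1 ≤ d' k → q ≤ (Finsupp.erase i d').degree := by
  classical
  intro d' hd' hk1
  have hdeg := degree_erase_add d' i
  have h3 := degree_three hij hjk hik d'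
  obtain ⟨a, ha⟩ : ∃ a, d' k = a := ⟨_, rfl⟩
  by_cases haq : a < q
  · have ha1 : 1 ≤ a := by omega
    have hmem : d' ∈ layer k a (step q j b s).F := mem_layer.mpr ⟨MvPolynomial.mem_support_iff.mp hd', ha⟩
    have hne : (layer k a s.F).Nonempty := by
      by_contra hne
      rw [Finset.not_nonempty_iff_eq_empty] at hne
      rw [layer_step_eq_empty hij hjk hik q b hbj hbk s hF hne] at hmem
      exact absurd hmem (Finset.notMem_empty _)
    obtain ⟨d₁, hd₁S, hd₁⟩ := exists_loSum_eq hne i j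
    have hq : q ≤ loSum (layer k a s.F) i j + a := by
      have h1 := hF d₁ (Finset.mem_filter.mp hd₁S).1
      have h2 := degree_three hij hjk hik d₁
      have h4 : d₁ k = a := (Finset.mem_filter.mp hd₁S).2
      omega
    have hsm := hdead a ha1 haq
    have hxy : lo (layer k a s.F) i + lo (layer k a s.F) j ≤ loSum (layer k a s.F) i j :=
      lo_add_lo_le_loSum i j
    have hrow : ∀ d ∈ (layer k a s.F).filter (fun d => d i + d j = loSum (layer k a s.F) i j), d = d₁ := by
      intro d hd
      have hd0 := (Finset.mem_filter.mp hd)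
      have e1 := lo_le hd0.1 i
      have e2 := lo_le hd0.1 j
      have e3 := lo_le hd₁S i
      have e4 := lo_le hd₁S j
      unfold sm at hsm
      exact eq_of_row hij hjk hik hd (Finset.mem_filter.mpr ⟨hd₁S, hd₁⟩) (by omega)
    have hc0 : (rowPoly i j k a (loSum (layer k a s.F) i j) (b i) s.F).coeff 0 ≠ 0 := by
      rw [coeff_rowPoly, Finset.sum_eq_single d₁]
      · rw [Nat.choose_zero_right, Nat.cast_one, one_mul, Nat.sub_zero]
        exact mul_ne_zero (MvPolynomial.mem_support_iff.mp (Finset.mem_filter.mp hd₁S).1) (pow_ne_zero _ hbi)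
      · intro d hd hne'
        exact absurd (hrow d hd) hne'
      · intro h'
        exact absurd (Finset.mem_filter.mpr ⟨hd₁S, hd₁⟩) h'
    have hpure : exp3 i j k 0 (loSum (layer k a s.F) i j + a - q) a ∈ (step q j b s).F.support := by
      rw [MvPolynomial.mem_support_iff, coeff_step_lowest_row hij hjk hik q b hbj hbk s hF ha1 haq hq]
      exact hc0
    have h5 := hF' _ hpure
    rw [degree_three hij hjk hik, exp3_i hij hik, exp3_j hij hjk, exp3_k hjk hik] at h5
    obtain ⟨d, hd, hline, -, -⟩ := origin_of_mem_layer_step hij hjk hik q b hbj hbk s hF hmem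
    have h6 := loSum_le hd i j
    omega
  · omega

/-- **THIN-LAYER-0 LAW, MOVE FORM (PROVED):** if the new state of such a move is ISOLATED, its layer `0` contains an
exponent `d` with `d_k = 0` and `d_j < q` (a monomial of low degree in the NEW exceptional variable `u_j`): were all
layer-`0` exponents `u_j`-heavy, the whole state would be fat off the `u_i`-axis (`fat_pos_of_dead_pos`) and the
`u_i`-axis would lie in the top locus (`not_isolatedTop_of_fat`). [new] [folklore] -/
theorem layer_zero_thin_of_isolated (q : ℕ) (b : Fin 3 → K) (hbj : b j = 0) (hbk : b k = 0) (hbi : b i ≠ 0)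
    (s : State (Fin 3) K) (hF : ∀ d ∈ s.F.support, q ≤ d.degree)
    (hF' : ∀ d ∈ (step q j b s).F.support, q ≤ d.degree)
    (hdead : ∀ a, 1 ≤ a → a < q → sm (layer k a s.F) i j = 0) (hiso : IsolatedTop q (step q j b s).F) :
    ∃ d ∈ (step q j b s).F.support, d k = 0 ∧ d j < q := by
  classical
  by_contra hno
  push Not at hno
  refine not_isolatedTop_of_fat q i _ (fun d' hd' => ?_) hiso
  rcases Nat.eq_zero_or_pos (d' k) with h0 | hpos
  · have h1 := hno d' hd' h0
    have hdeg := degree_erase_add d' i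
    have h3 := degree_three hij hjk hik d'
    omega
  · exact fat_pos_of_dead_pos hij hjk hik q b hbj hbk hbi s hF hF' hdead d' hd' hpos

/-- **LOW-LAYER-0 LAW, MOVE FORM (PROVED):** under the same hypotheses the OLD layer `0` contains an exponent of total
degree `< 2q` — the thin new exponent comes from an old layer-`0` exponent on the line `|d| = d'_j + q`
(`origin_of_mem_layer_step`).  Read at the level of the coefficient datum: at every translated move of the monomial
regime `q ≤ ord G⁽⁰⁾ < 2q`. [new] [folklore] -/
theorem layer_zero_low_of_isolated (q : ℕ) (b : Fin 3 → K) (hbj : b j = 0) (hbk : b k = 0) (hbi : b i ≠ 0)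
    (s : State (Fin 3) K) (hF : ∀ d ∈ s.F.support, q ≤ d.degree)
    (hF' : ∀ d ∈ (step q j b s).F.support, q ≤ d.degree)
    (hdead : ∀ a, 1 ≤ a → a < q → sm (layer k a s.F) i j = 0) (hiso : IsolatedTop q (step q j b s).F) :
    ∃ d ∈ s.F.support, d k = 0 ∧ d.degree < 2 * q := by
  classical
  obtain ⟨d', hd', hk0, hjq⟩ := layer_zero_thin_of_isolated hij hjk hik q b hbj hbk hbi s hF hF' hdead hiso
  have hmem : d' ∈ layer k 0 (step q j b s).F := mem_layer.mpr ⟨MvPolynomial.mem_support_iff.mp hd', hk0⟩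
  obtain ⟨d, hd, hline, -, -⟩ := origin_of_mem_layer_step hij hjk hik q b hbj hbk s hF hmem
  rw [mem_layer] at hd
  refine ⟨d, MvPolynomial.mem_support_iff.mpr hd.1, hd.2, ?_⟩
  rw [degree_three hij hjk hik d]
  omega

end Moves

/-! ## §3 The two laws along a walk: every LATE TRANSLATED move of a planar tail in the monomial regime -/

section WalkLaws

variable {K : Type} [Field K] [DecidableEq K] {q : ℕ} {s₀ : State (Fin 3) K}
variable {i j k : Fin 3} (hij : i ≠ j) (hjk : j ≠ k) (hik : i ≠ k)
include hij hjk hik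

/-- **THIN-LAYER-0 LAW (PROVED, walk form):** on a planar tail (plane `u_k = 0`) in the monomial regime, after every
TRANSLATED move `t` the new layer `0` has an exponent with `d_k = 0` and `d_{j_t} < q` (`j_t = W.j t` the chart).
[new] [folklore] -/
theorem layer_zero_thin_after_translated (hs : IsRoot q s₀) (W : ForcedWalk q s₀) {N : ℕ} (hP : PlanarFrom W k N)
    {T : ℕ} (hNT : N ≤ T) (hdead : ∀ t, T ≤ t → ∀ a, 1 ≤ a → a < q → sm (layer k a (W.st t).F) i j = 0)
    {t : ℕ} (hTt : T ≤ t) (hbt : W.b t ≠ 0) :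
    ∃ d ∈ (W.st (t + 1)).F.support, d k = 0 ∧ d (W.j t) < q := by
  classical
  have ht : N ≤ t := le_trans hNT hTt
  have hF : ∀ d ∈ (W.st t).F.support, q ≤ d.degree := fun d hd => le_degree_of_mem_support hs W t hd
  have hF' : ∀ d ∈ (step q (W.j t) (W.b t) (W.st t)).F.support, q ≤ d.degree := by
    intro d hd
    rw [← st_succ_F] at hd
    exact le_degree_of_mem_support hs W (t + 1) hd
  obtain ⟨hjk0, hbk0⟩ := hP t ht
  have hiso := W.isolated (t + 1)
  rw [st_succ_F] at hiso ⊢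
  rcases PlanarCut.fin3_cases ⟨hij, hjk, hik⟩ (W.j t) with h | h | h
  · -- chart `u_i`, translation in `u_j`: roles `(j, i, k)`
    have hbj : W.b t j ≠ 0 := by
      intro hbj
      apply hbt
      funext l
      rcases PlanarCut.fin3_cases ⟨hij, hjk, hik⟩ l with rfl | rfl | rfl
      · rw [← h]; exact W.onExc t
      · exact hbj
      · exact hbk0
    rw [h] at hF' hiso ⊢
    exact layer_zero_thin_of_isolated hij.symm hik hjk q (W.b t) (by rw [← h]; exact W.onExc t) hbk0 hbj (W.st t)
      hF hF' (fun a ha1 haq => by rw [sm_comm]; exact hdead t hTt a ha1 haq) hiso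
  · have hbi : W.b t i ≠ 0 := by
      intro hbi
      apply hbt
      funext l
      rcases PlanarCut.fin3_cases ⟨hij, hjk, hik⟩ l with rfl | rfl | rfl
      · exact hbi
      · rw [← h]; exact W.onExc t
      · exact hbk0
    rw [h] at hF' hiso ⊢
    exact layer_zero_thin_of_isolated hij hjk hik q (W.b t) (by rw [← h]; exact W.onExc t) hbk0 hbi (W.st t) hF hF'
      (hdead t hTt) hiso
  · exact absurd h hjk0

/-- **LOW-LAYER-0 LAW (PROVED, walk form):** … and BEFORE every translated move `t` the old layer `0` has an exponent
of degree `< 2q`; in particular `ord₀ F_t < 2q`, i.e. the excess `m_t = ord₀ F_t − q` is `< q` at every late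
translated move of such a tail. [new] [folklore] -/
theorem layer_zero_low_at_translated (hs : IsRoot q s₀) (W : ForcedWalk q s₀) {N : ℕ} (hP : PlanarFrom W k N)
    {T : ℕ} (hNT : N ≤ T) (hdead : ∀ t, T ≤ t → ∀ a, 1 ≤ a → a < q → sm (layer k a (W.st t).F) i j = 0)
    {t : ℕ} (hTt : T ≤ t) (hbt : W.b t ≠ 0) :
    ∃ d ∈ (W.st t).F.support, d k = 0 ∧ d.degree < 2 * q := by
  classical
  have ht : N ≤ t := le_trans hNT hTt
  have hF : ∀ d ∈ (W.st t).F.support, q ≤ d.degree := fun d hd => le_degree_of_mem_support hs W t hd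
  have hF' : ∀ d ∈ (step q (W.j t) (W.b t) (W.st t)).F.support, q ≤ d.degree := by
    intro d hd
    rw [← st_succ_F] at hd
    exact le_degree_of_mem_support hs W (t + 1) hd
  obtain ⟨hjk0, hbk0⟩ := hP t ht
  have hiso := W.isolated (t + 1)
  rw [st_succ_F] at hiso
  rcases PlanarCut.fin3_cases ⟨hij, hjk, hik⟩ (W.j t) with h | h | h
  · have hbj : W.b t j ≠ 0 := by
      intro hbj
      apply hbt
      funext l
      rcases PlanarCut.fin3_cases ⟨hij, hjk, hik⟩ l with rfl | rfl | rfl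
      · rw [← h]; exact W.onExc t
      · exact hbj
      · exact hbk0
    rw [h] at hF' hiso
    exact layer_zero_low_of_isolated hij.symm hik hjk q (W.b t) (by rw [← h]; exact W.onExc t) hbk0 hbj (W.st t)
      hF hF' (fun a ha1 haq => by rw [sm_comm]; exact hdead t hTt a ha1 haq) hiso
  · have hbi : W.b t i ≠ 0 := by
      intro hbi
      apply hbt
      funext l
      rcases PlanarCut.fin3_cases ⟨hij, hjk, hik⟩ l with rfl | rfl | rfl
      · exact hbi
      · rw [← h]; exact W.onExc t
      · exact hbk0
    rw [h] at hF' hiso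
    exact layer_zero_low_of_isolated hij hjk hik q (W.b t) (by rw [← h]; exact W.onExc t) hbk0 hbi (W.st t) hF hF'
      (hdead t hTt) hiso
  · exact absurd h hjk0

/-- Corollary: `ord₀ F_t < 2q` at every late translated move of a planar tail in the monomial regime. [new] [folklore] -/
theorem ordZero_lt_at_translated (hs : IsRoot q s₀) (W : ForcedWalk q s₀) {N : ℕ} (hP : PlanarFrom W k N)
    {T : ℕ} (hNT : N ≤ T) (hdead : ∀ t, T ≤ t → ∀ a, 1 ≤ a → a < q → sm (layer k a (W.st t).F) i j = 0)
    {t : ℕ} (hTt : T ≤ t) (hbt : W.b t ≠ 0) : ordZero (W.st t).F < ((2 * q : ℕ) : ℕ∞) := by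
  obtain ⟨d, hd, -, hlt⟩ := layer_zero_low_at_translated hij hjk hik hs W hP hNT hdead hTt hbt
  have h1 : ordZero (W.st t).F ≤ (d.degree : ℕ∞) :=
    not_lt.mp fun h => (MvPolynomial.mem_support_iff.mp hd) (coeff_eq_zero_of_degree_lt_ordZero h)
  exact lt_of_le_of_lt h1 (by exact_mod_cast hlt)

end WalkLaws

end Summit.ResolutionOfSingularities.ResolutionOfSingularities.Theorems.CoefficientCut
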